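import Literature.NumberTheory.LFunctions.RieszMeanPerron
import Literature.Analysis.Complex.CahenMellinDirichlet
import HarnessLib

/-!
# Perron's formula of order three and the value of a Dirichlet series at a point left of the
# line of absolute convergence

Topic `Literature/NumberTheory/LFunctions`.  Everything in this file is PROVED; no definitions, no named facts.
It is the contour-integration step of the classical deduction "exponential-sum bound ⟹ order of a Dirichlet
series near `σ = 1`" (Titchmarsh, *The Theory of the Riemann Zeta-Function*, §§5.1–5.3 for `ζ`; here for a
general Dirichlet series with an entire continuation of polynomial growth, as needed for the Hecke `L`-functions
`L(s, λ^m)` of `ℚ(i)` in `GaussianHeckeRichertBound.lean`), in the Riesz-mean form of Landau /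
Montgomery–Vaughan §5.1 (5.19) with `k = 3` (so that every integral converges absolutely):

* `hasMellin_oneSub_cube_indicator`, `mellinInv_kernel_eq` — the Mellin pair
  `(1 − y)³ 𝟙_{(0,1]}(y) ↔ 6/(s(s+1)(s+2)(s+3))` (`Re s > 0`) and its inversion
  `(1/2πi)∫_{(σ)} y^{-s} · 6 ds/(s(s+1)(s+2)(s+3)) = ((1 − y)⁺)³` (Mathlib's `mellinInv_mellin_eq`);
* `sum_mul_sub_cube_eq_integral_LSeries` — **Perron's formula of order three** (MV (5.19), `k = 3`): if
  `∑ f(n) n^{-σ}` converges absolutely, `σ > 0`, `x > 0`, then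
  `∑_{n ≤ x} f(n)(x − n)³ = (1/2π) ∫ x^{3+s} L(f, s) · 6 dt/(s(s+1)(s+2)(s+3))`, `s = σ + it`;
* `norm_apply_zero_le` — **the pointwise bound**: if moreover `L(f, ·)` agrees on `Re s = c` (`c > 0`) with an
  ENTIRE function `Φ` satisfying `‖Φ(u)‖ ≤ A (K₁ + |Im u|)²` for `−3/4 ≤ Re u ≤ c`, then for `x ≥ 1`
  `‖Φ(0)‖ ≤ x⁻³ ‖∑_{n ≤ x} f(n)(x − n)³‖ + 12288 · A · K₁² · x^{−3/4}`
  (shift the line to `Re u = −3/4` across the simple pole of the kernel at `u = 0`, residue `x³ Φ(0)`, by the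
  tree's residue theorem for vertical strips `Literature.Analysis.Complex.integral_vertical_sub_eq_sum_of_simplePoles`;
  the kernel is `≤ 96 δ⁻⁴ (1 + |t|)⁻⁴` on a line at distance `≥ δ` from its poles).

Model (the consumer): `f(n) = c_m(n) n^{-s₀}`, `Φ(u) = D_m(s₀ + u)`, `c = max(1 − σ₀, 0) + 1/log V`, `x = V⁴`.

## References

* H. L. Montgomery, R. C. Vaughan, *Multiplicative Number Theory I*, CUP 2007, §5.1 (5.17)–(5.19).
  [cite: MontgomeryVaughan2007, §5.1 (5.19)]
* E. C. Titchmarsh, *The Theory of the Riemann Zeta-Function*, 2nd ed. (1986), §3.12, §5.3. [cite: Titchmarsh1986, §5.3]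
-/

noncomputable section

open Complex Filter Set MeasureTheory Real
open scoped Topology

namespace Literature.NumberTheory.LFunctions

namespace RieszPerron3

/-! ## The kernel `6/(s(s+1)(s+2)(s+3))` -/

/-- If `Re s + j` has absolute value `≥ δ` with `0 < δ ≤ 1`, then `‖s + j‖ ≥ δ(1 + |Im s|)/2`. [folklore] -/
theorem norm_add_ge {s : ℂ} {δ : ℝ} (j : ℝ) (hδ : 0 < δ) (hδ1 : δ ≤ 1) (h : δ ≤ |s.re + j|) :
    δ * (1 + |s.im|) / 2 ≤ ‖s + j‖ := by
  have hre : |(s + j).re| ≤ ‖s + j‖ := Complex.abs_re_le_norm _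
  have him : |(s + j).im| ≤ ‖s + j‖ := Complex.abs_im_le_norm _
  simp only [add_re, ofReal_re, add_im, ofReal_im, add_zero] at hre him
  rcases le_or_gt |s.im| 1 with ht | ht
  · -- `δ(1+|t|)/2 ≤ δ ≤ |σ + j| ≤ ‖s + j‖`
    have : δ * (1 + |s.im|) / 2 ≤ δ := by nlinarith [abs_nonneg s.im]
    linarith
  · -- `δ(1+|t|)/2 ≤ (1+|t|)/2 ≤ |t| ≤ ‖s + j‖`
    have : δ * (1 + |s.im|) / 2 ≤ (1 + |s.im|) / 2 := by nlinarith [abs_nonneg s.im]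
    linarith

/-- **The kernel bound on a vertical line at distance `≥ δ` from the poles**: if `0 < δ ≤ 1` and
`|Re s|, |Re s + 1|, |Re s + 2|, |Re s + 3| ≥ δ`, then `‖6/(s(s+1)(s+2)(s+3))‖ ≤ 96/(δ⁴ (1 + |Im s|)⁴)`. [folklore] -/
theorem norm_kernel_le {s : ℂ} {δ : ℝ} (hδ : 0 < δ) (hδ1 : δ ≤ 1) (h0 : δ ≤ |s.re|) (h1 : δ ≤ |s.re + 1|)
    (h2 : δ ≤ |s.re + 2|) (h3 : δ ≤ |s.re + 3|) :
    ‖(6 : ℂ) / (s * (s + 1) * (s + 2) * (s + 3))‖ ≤ 96 / (δ ^ 4 * (1 + |s.im|) ^ 4) := by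
  have e0 : s = s + ((0 : ℝ) : ℂ) := by simp
  have g0 := norm_add_ge (s := s) (0 : ℝ) hδ hδ1 (by simpa using h0)
  have g1 := norm_add_ge (s := s) (1 : ℝ) hδ hδ1 h1
  have g2 := norm_add_ge (s := s) (2 : ℝ) hδ hδ1 h2
  have g3 := norm_add_ge (s := s) (3 : ℝ) hδ hδ1 h3
  simp only [ofReal_zero, add_zero] at g0
  simp only [ofReal_one] at g1
  have e2 : ((2 : ℝ) : ℂ) = 2 := by norm_num
  have e3 : ((3 : ℝ) : ℂ) = 3 := by norm_num
  rw [e2] at g2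
  rw [e3] at g3
  set u : ℝ := δ * (1 + |s.im|) / 2 with hu
  have hu0 : 0 < u := by rw [hu]; positivity
  have hprod : u ^ 4 ≤ ‖s * (s + 1) * (s + 2) * (s + 3)‖ := by
    rw [norm_mul, norm_mul, norm_mul]
    calc u ^ 4 = u * u * u * u := by ring
      _ ≤ ‖s‖ * ‖s + 1‖ * ‖s + 2‖ * ‖s + 3‖ := by
          apply mul_le_mul (mul_le_mul (mul_le_mul g0 g1 hu0.le (norm_nonneg _)) g2 hu0.le (by positivity))
            g3 hu0.le (by positivity)
  have hpos : 0 < ‖s * (s + 1) * (s + 2) * (s + 3)‖ := lt_of_lt_of_le (by positivity) hprod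
  rw [norm_div, show ‖(6 : ℂ)‖ = 6 by simp]
  rw [div_le_div_iff₀ hpos (by positivity)]
  have hu4 : u ^ 4 = δ ^ 4 * (1 + |s.im|) ^ 4 / 16 := by rw [hu]; ring
  nlinarith [hprod, hu4]

/-- The kernel does not vanish under the hypotheses of `norm_kernel_le`. [folklore] -/
theorem kernelDen_ne_zero {s : ℂ} {δ : ℝ} (hδ : 0 < δ) (hδ1 : δ ≤ 1) (h0 : δ ≤ |s.re|) (h1 : δ ≤ |s.re + 1|)
    (h2 : δ ≤ |s.re + 2|) (h3 : δ ≤ |s.re + 3|) : s * (s + 1) * (s + 2) * (s + 3) ≠ 0 := by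
  intro h
  -- each factor is nonzero since its norm is `≥ δ(1+|t|)/2 > 0`
  have g0 := norm_add_ge (s := s) (0 : ℝ) hδ hδ1 (by simpa using h0)
  have g1 := norm_add_ge (s := s) (1 : ℝ) hδ hδ1 h1
  have g2 := norm_add_ge (s := s) (2 : ℝ) hδ hδ1 h2
  have g3 := norm_add_ge (s := s) (3 : ℝ) hδ hδ1 h3
  have hu0 : 0 < δ * (1 + |s.im|) / 2 := by positivity
  simp only [ofReal_zero, add_zero] at g0
  simp only [ofReal_one] at g1
  have e2 : ((2 : ℝ) : ℂ) = 2 := by norm_num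
  have e3 : ((3 : ℝ) : ℂ) = 3 := by norm_num
  rw [e2] at g2
  rw [e3] at g3
  have n0 : s ≠ 0 := norm_pos_iff.1 (hu0.trans_le g0)
  have n1 : s + 1 ≠ 0 := norm_pos_iff.1 (hu0.trans_le g1)
  have n2 : s + 2 ≠ 0 := norm_pos_iff.1 (hu0.trans_le g2)
  have n3 : s + 3 ≠ 0 := norm_pos_iff.1 (hu0.trans_le g3)
  exact mul_ne_zero (mul_ne_zero (mul_ne_zero n0 n1) n2) n3 h

/-- On a vertical line `Re s = σ > 0`: `‖6/(s(s+1)(s+2)(s+3))‖ ≤ 96/(min(σ,1)⁴ (1 + |t|)⁴)`. [folklore] -/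
theorem norm_kernel_le_of_pos {σ : ℝ} (hσ : 0 < σ) (t : ℝ) :
    ‖(6 : ℂ) / (((σ : ℂ) + t * I) * ((σ : ℂ) + t * I + 1) * ((σ : ℂ) + t * I + 2) * ((σ : ℂ) + t * I + 3))‖ ≤
      96 / ((min σ 1) ^ 4 * (1 + |t|) ^ 4) := by
  have hδ : 0 < min σ 1 := lt_min hσ one_pos
  have hδ1 : min σ 1 ≤ 1 := min_le_right _ _
  have hδσ : min σ 1 ≤ σ := min_le_left _ _
  have hre : ((σ : ℂ) + t * I).re = σ := by simp
  have him : ((σ : ℂ) + t * I).im = t := by simp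
  have h := norm_kernel_le (s := (σ : ℂ) + t * I) hδ hδ1 (by rw [hre, abs_of_pos hσ]; exact hδσ)
    (by rw [hre, abs_of_pos (by linarith)]; linarith) (by rw [hre, abs_of_pos (by linarith)]; linarith)
    (by rw [hre, abs_of_pos (by linarith)]; linarith)
  rwa [him] at h

/-- The kernel on `Re s = σ > 0` is dominated by `96 min(σ,1)⁻⁴ (1 + t²)⁻¹`. [folklore] -/
theorem norm_kernel_le_inv_one_add_sq {σ : ℝ} (hσ : 0 < σ) (t : ℝ) :
    ‖(6 : ℂ) / (((σ : ℂ) + t * I) * ((σ : ℂ) + t * I + 1) * ((σ : ℂ) + t * I + 2) * ((σ : ℂ) + t * I + 3))‖ ≤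
      96 / (min σ 1) ^ 4 * (1 + t ^ 2)⁻¹ := by
  refine (norm_kernel_le_of_pos hσ t).trans ?_
  have hδ : 0 < min σ 1 := lt_min hσ one_pos
  have key : 1 + t ^ 2 ≤ (1 + |t|) ^ 4 := by
    have h2 : 1 + t ^ 2 ≤ (1 + |t|) ^ 2 := by rw [← sq_abs t]; nlinarith [abs_nonneg t]
    have h1 : 1 ≤ (1 + |t|) ^ 2 := by nlinarith [abs_nonneg t]
    nlinarith
  calc 96 / ((min σ 1) ^ 4 * (1 + |t|) ^ 4) = 96 / (min σ 1) ^ 4 * ((1 + |t|) ^ 4)⁻¹ := by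
        rw [← div_div, div_eq_mul_inv]
    _ ≤ 96 / (min σ 1) ^ 4 * (1 + t ^ 2)⁻¹ :=
        mul_le_mul_of_nonneg_left (inv_anti₀ (by positivity) key) (by positivity)

/-- The kernel is integrable along `Re s = σ > 0`. [folklore] -/
theorem integrable_kernel {σ : ℝ} (hσ : 0 < σ) :
    Integrable fun t : ℝ ↦ (6 : ℂ) / (((σ : ℂ) + t * I) * ((σ : ℂ) + t * I + 1) * ((σ : ℂ) + t * I + 2) *
      ((σ : ℂ) + t * I + 3)) := by
  have hδ : 0 < min σ 1 := lt_min hσ one_pos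
  have hδσ : min σ 1 ≤ σ := min_le_left _ _
  have hδ1 : min σ 1 ≤ 1 := min_le_right _ _
  have hre : ∀ t : ℝ, ((σ : ℂ) + t * I).re = σ := fun t ↦ by simp
  have hden : ∀ t : ℝ, ((σ : ℂ) + t * I) * ((σ : ℂ) + t * I + 1) * ((σ : ℂ) + t * I + 2) *
      ((σ : ℂ) + t * I + 3) ≠ 0 := fun t ↦
    kernelDen_ne_zero (s := (σ : ℂ) + t * I) hδ hδ1 (by rw [hre, abs_of_pos hσ]; exact hδσ)
      (by rw [hre, abs_of_pos (by linarith)]; linarith)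
      (by rw [hre, abs_of_pos (by linarith)]; linarith)
      (by rw [hre, abs_of_pos (by linarith)]; linarith)
  have hc : Continuous fun t : ℝ ↦ (6 : ℂ) / (((σ : ℂ) + t * I) * ((σ : ℂ) + t * I + 1) * ((σ : ℂ) + t * I + 2) *
      ((σ : ℂ) + t * I + 3)) := Continuous.div continuous_const (by fun_prop) hden
  refine ((integrable_inv_one_add_sq.const_mul (96 / (min σ 1) ^ 4))).mono' hc.aestronglyMeasurable
    (Eventually.of_forall fun t ↦ ?_)
  exact norm_kernel_le_inv_one_add_sq hσ t

/-! ## The Mellin pair `(1 − y)³ 𝟙_{(0,1]} ↔ 6/(s(s+1)(s+2)(s+3))` -/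

/-- The Mellin transform of `f(y) = (1 − y)³ 𝟙_{(0,1]}(y)` is `6/(s(s+1)(s+2)(s+3))` for `Re s > 0`
(`(1−y)³ = 1 − 3y + 3y² − y³` and `hasMellin_one_Ioc`, `hasMellin_cpow_Ioc`). [folklore] -/
theorem hasMellin_oneSub_cube_indicator {s : ℂ} (hs : 0 < s.re) :
    HasMellin ((Ioc 0 1).indicator fun y : ℝ ↦ ((1 : ℂ) - y) ^ 3) s
      (6 / (s * (s + 1) * (s + 2) * (s + 3))) := by
  have h0 := hasMellin_one_Ioc hs
  have h1 := hasMellin_cpow_Ioc ((1 : ℕ) : ℂ) (s := s) (by simp; linarith)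
  have h2 := hasMellin_cpow_Ioc ((2 : ℕ) : ℂ) (s := s) (by simp; linarith)
  have h3 := hasMellin_cpow_Ioc ((3 : ℕ) : ℂ) (s := s) (by simp; linarith)
  -- `g = 𝟙 - 3·𝟙y + 3·𝟙y² - 𝟙y³`
  have hA := hasMellin_sub h0.1 (h1.1.const_smul (3 : ℂ))
  have hB := hasMellin_add hA.1 (h2.1.const_smul (3 : ℂ))
  have hC := hasMellin_sub hB.1 h3.1
  have hm1 := (hasMellin_const_smul h1.1 (3 : ℂ)).2
  have hm2 := (hasMellin_const_smul h2.1 (3 : ℂ)).2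
  rw [h1.2] at hm1
  rw [h2.2] at hm2
  rw [hB.2, hA.2, h0.2, hm1, hm2, h3.2] at hC
  have hs0 : s ≠ 0 := by rintro rfl; simp at hs
  have hs1 : s + 1 ≠ 0 := by
    intro h; have := congrArg Complex.re h; simp at this; linarith
  have hs2 : s + 2 ≠ 0 := by
    intro h; have := congrArg Complex.re h; simp at this; linarith
  have hs3 : s + 3 ≠ 0 := by
    intro h; have := congrArg Complex.re h; simp at this; linarith
  have heq : (fun y : ℝ ↦ (Ioc 0 1).indicator (fun _ : ℝ ↦ (1 : ℂ)) y -
        (3 : ℂ) • (Ioc 0 1).indicator (fun t : ℝ ↦ (t : ℂ) ^ ((1 : ℕ) : ℂ)) y +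
        (3 : ℂ) • (Ioc 0 1).indicator (fun t : ℝ ↦ (t : ℂ) ^ ((2 : ℕ) : ℂ)) y -
        (Ioc 0 1).indicator (fun t : ℝ ↦ (t : ℂ) ^ ((3 : ℕ) : ℂ)) y) =
      (Ioc 0 1).indicator fun y : ℝ ↦ ((1 : ℂ) - y) ^ 3 := by
    funext y
    by_cases hy : y ∈ Ioc (0 : ℝ) 1
    · simp only [Set.indicator_of_mem hy, cpow_natCast, smul_eq_mul]
      ring
    · simp [Set.indicator_of_notMem hy]
  rw [heq] at hC
  refine ⟨hC.1, ?_⟩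
  rw [hC.2]
  have e1 : s + ((1 : ℕ) : ℂ) = s + 1 := by norm_num
  have e2 : s + ((2 : ℕ) : ℂ) = s + 2 := by norm_num
  have e3 : s + ((3 : ℕ) : ℂ) = s + 3 := by norm_num
  rw [e1, e2, e3, smul_eq_mul, smul_eq_mul]
  field_simp
  ring

/-- **The Perron kernel of order three.** For `σ > 0` and `y > 0`,
`(1/2πi) ∫_{(σ)} y^{−s} · 6 ds/(s(s+1)(s+2)(s+3)) = ((1 − y)⁺)³` (Mellin inversion, `mellinInv_mellin_eq`).
[cite: MontgomeryVaughan2007, §5.1 (5.17)–(5.18)] -/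
theorem mellinInv_kernel_eq {σ : ℝ} (hσ : 0 < σ) {y : ℝ} (hy : 0 < y) :
    mellinInv σ (fun s ↦ 6 / (s * (s + 1) * (s + 2) * (s + 3))) y = (((max (1 - y) 0) ^ 3 : ℝ) : ℂ) := by
  set f : ℝ → ℂ := (Ioc 0 1).indicator fun y : ℝ ↦ ((1 : ℂ) - y) ^ 3 with hf
  have hmel : ∀ t : ℝ, mellin f (σ + t * I) =
      6 / ((σ + t * I) * (σ + t * I + 1) * (σ + t * I + 2) * (σ + t * I + 3)) := fun t ↦
    (hasMellin_oneSub_cube_indicator (s := σ + t * I) (by simpa using hσ)).2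
  have hconv : MellinConvergent f σ := (hasMellin_oneSub_cube_indicator (s := σ) (by simpa using hσ)).1
  have hvert : VerticalIntegrable (mellin f) σ := by
    unfold VerticalIntegrable
    exact (integrable_kernel hσ).congr (Eventually.of_forall fun t ↦ (hmel t).symm)
  have hfeq : ∀ u : ℝ, 0 < u → f u = (((max (1 - u) 0) ^ 3 : ℝ) : ℂ) := by
    intro u hu
    by_cases hu1 : u ≤ 1
    · rw [hf, Set.indicator_of_mem (show u ∈ Ioc (0 : ℝ) 1 from ⟨hu, hu1⟩),
        max_eq_left (by linarith)]
      push_cast; ring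
    · rw [hf, Set.indicator_of_notMem (show u ∉ Ioc (0 : ℝ) 1 from fun h ↦ hu1 h.2),
        max_eq_right (by linarith)]
      simp
  have hcont : ContinuousAt f y := by
    have hev : f =ᶠ[𝓝 y] fun u ↦ (((max (1 - u) 0) ^ 3 : ℝ) : ℂ) := by
      filter_upwards [Ioi_mem_nhds hy] with u hu
      exact hfeq u hu
    refine (ContinuousAt.congr ?_ hev.symm)
    exact (Complex.continuous_ofReal.comp (((continuous_const.sub continuous_id).max
      continuous_const).pow 3)).continuousAt
  have hinv := mellinInv_mellin_eq σ f hy hconv hvert hcont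
  rw [hfeq y hy] at hinv
  rw [← hinv]
  unfold mellinInv
  congr 1
  refine integral_congr_ae (Eventually.of_forall fun t ↦ ?_)
  simp only [hmel t]

/-! ## Perron's formula of order three -/

/-- One term: for `x > 0`, `σ > 0`, `n ≥ 1`,
`f(n) ((x − n)⁺)³ = (1/2π) ∫ x^{3+s} f(n) n^{−s} · 6 dt/(s(s+1)(s+2)(s+3))`, `s = σ + it`. [folklore] -/
theorem apply_mul_posPart_cube_eq_integral (f : ℕ → ℂ) {x : ℝ} (hx : 0 < x) {σ : ℝ} (hσ : 0 < σ)
    {n : ℕ} (hn : n ≠ 0) :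
    f n * (((max (x - n) 0) ^ 3 : ℝ) : ℂ) =
      (1 / (2 * π) : ℂ) * ∫ t : ℝ, (x : ℂ) ^ (3 + (σ + t * I)) *
        LSeries.term f (σ + t * I) n *
          (6 / ((σ + t * I) * (σ + t * I + 1) * (σ + t * I + 2) * (σ + t * I + 3))) := by
  have hn0 : (0 : ℝ) < n := Nat.cast_pos.2 (Nat.pos_of_ne_zero hn)
  have hy : 0 < (n : ℝ) / x := div_pos hn0 hx
  have hK := mellinInv_kernel_eq hσ hy
  unfold mellinInv at hK
  have hmax : x ^ 3 * (max (1 - n / x) 0) ^ 3 = (max (x - n) 0) ^ 3 := by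
    rw [← mul_pow, mul_max_of_nonneg _ _ hx.le, mul_sub, mul_one, mul_div_cancel₀ _ hx.ne', mul_zero]
  have hlhs : f n * (((max (x - n) 0) ^ 3 : ℝ) : ℂ) =
      f n * (x : ℂ) ^ 3 * (((max (1 - (n : ℝ) / x) 0) ^ 3 : ℝ) : ℂ) := by
    rw [← hmax]; push_cast; ring
  rw [hlhs, ← hK, Complex.real_smul]
  have hx0 : (x : ℂ) ≠ 0 := ofReal_ne_zero.2 hx.ne'
  have hnC : (n : ℂ) ≠ 0 := Nat.cast_ne_zero.2 hn
  have hpt : ∀ t : ℝ, f n * (x : ℂ) ^ 3 *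
      (((n : ℂ) / (x : ℂ)) ^ (-((σ : ℂ) + t * I)) •
        (6 / ((((σ : ℂ) + t * I)) * (((σ : ℂ) + t * I) + 1) * (((σ : ℂ) + t * I) + 2) *
          (((σ : ℂ) + t * I) + 3)))) =
      (x : ℂ) ^ (3 + (σ + t * I)) * LSeries.term f (σ + t * I) n *
        (6 / ((σ + t * I) * (σ + t * I + 1) * (σ + t * I + 2) * (σ + t * I + 3))) := by
    intro t
    set s : ℂ := σ + t * I with hs
    simp only [smul_eq_mul]
    have hpow : ((n : ℂ) / (x : ℂ)) ^ (-s) = (x : ℂ) ^ s / (n : ℂ) ^ s := by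
      rw [show (n : ℂ) / (x : ℂ) = (((n : ℝ) * x⁻¹ : ℝ) : ℂ) by push_cast; ring, cpow_neg,
        ofReal_mul, mul_cpow_ofReal_nonneg hn0.le (inv_nonneg.2 hx.le), ofReal_inv,
        inv_cpow _ _ ?_, mul_inv, inv_inv]
      · simp only [ofReal_natCast]; ring
      · rw [arg_ofReal_of_nonneg hx.le]; exact Real.pi_pos.ne
    rw [hpow, LSeries.term_of_ne_zero hn]
    have e3 : (x : ℂ) ^ (3 + s) = (x : ℂ) ^ 3 * (x : ℂ) ^ s := by
      rw [cpow_add _ _ hx0, cpow_ofNat]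
    rw [e3]
    field_simp
  calc f n * (x : ℂ) ^ 3 * ((((1 / (2 * π) : ℝ)) : ℂ) *
        ∫ t : ℝ, (((n : ℝ) / x : ℝ) : ℂ) ^ (-((σ : ℂ) + t * I)) •
          (fun s : ℂ ↦ 6 / (s * (s + 1) * (s + 2) * (s + 3))) ((σ : ℂ) + t * I))
      = (((1 / (2 * π) : ℝ)) : ℂ) * ∫ t : ℝ, f n * (x : ℂ) ^ 3 *
          ((((n : ℝ) / x : ℝ) : ℂ) ^ (-((σ : ℂ) + t * I)) •
            (fun s : ℂ ↦ 6 / (s * (s + 1) * (s + 2) * (s + 3))) ((σ : ℂ) + t * I)) := by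
        rw [integral_const_mul]; ring
    _ = _ := by
        push_cast
        congr 1
        exact integral_congr_ae (Eventually.of_forall hpt)

/-- Norm of the `n`-th weighted term on `Re s = σ`: `x^{3+σ} ‖f(n) n^{-σ}‖`. [folklore] -/
theorem norm_cpow_mul_term (f : ℕ → ℂ) {x : ℝ} (hx : 0 < x) (σ t : ℝ) (n : ℕ) :
    ‖(x : ℂ) ^ (3 + (σ + t * I)) * LSeries.term f (σ + t * I) n‖ =
      x ^ (3 + σ) * ‖LSeries.term f σ n‖ := by
  rw [norm_mul]
  congr 1
  · rw [norm_cpow_eq_rpow_re_of_pos hx]; simp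
  · rcases eq_or_ne n 0 with rfl | hn
    · simp [LSeries.term_zero]
    · rw [LSeries.norm_term_eq, LSeries.norm_term_eq]
      simp [hn]

/-- Continuity in `t` of the weighted term `x^{3+σ+it} f(n) n^{-(σ+it)}`. [folklore] -/
theorem continuous_cpow_mul_term (f : ℕ → ℂ) {x : ℝ} (hx : 0 < x) (σ : ℝ) (n : ℕ) :
    Continuous fun t : ℝ ↦ (x : ℂ) ^ (3 + (σ + t * I)) * LSeries.term f (σ + t * I) n := by
  have hx0 : (x : ℂ) ≠ 0 := ofReal_ne_zero.2 hx.ne'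
  refine Continuous.mul ?_ ?_
  · refine continuous_iff_continuousAt.2 fun t ↦ ?_
    exact (continuousAt_const_cpow hx0).comp (f := fun t : ℝ ↦ 3 + ((σ : ℂ) + t * I)) (by fun_prop)
  · rcases eq_or_ne n 0 with rfl | hn
    · simp only [LSeries.term_zero]; exact continuous_const
    · simp only [LSeries.term_of_ne_zero hn]
      refine continuous_const.div ?_ fun t ↦ ?_
      · refine continuous_iff_continuousAt.2 fun t ↦ ?_
        exact (continuousAt_const_cpow (Nat.cast_ne_zero.2 hn)).comp
          (f := fun t : ℝ ↦ ((σ : ℂ) + t * I)) (by fun_prop)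
      · exact cpow_ne_zero_iff.2 (Or.inl (Nat.cast_ne_zero.2 hn))

/-- **Perron's formula of order three** (Montgomery–Vaughan (5.19), `k = 3`): if `∑ f(n) n^{-σ}` converges
absolutely, `σ > 0`, then for every `x > 0`,
`∑_{n ≤ x} f(n) (x − n)³ = (1/2π) ∫ x^{3+s} L(f, s) · 6 dt/(s(s+1)(s+2)(s+3))`, `s = σ + it`, the integral
converging absolutely. [cite: MontgomeryVaughan2007, §5.1 (5.19)] -/
theorem sum_mul_sub_cube_eq_integral_LSeries (f : ℕ → ℂ) {x : ℝ} (hx : 0 < x) {σ : ℝ} (hσ : 0 < σ)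
    (hsum : LSeriesSummable f σ) :
    ∑ n ∈ Finset.Ioc 0 ⌊x⌋₊, f n * ((x : ℂ) - n) ^ 3 =
      (1 / (2 * π) : ℂ) * ∫ t : ℝ, (x : ℂ) ^ (3 + (σ + t * I)) *
        LSeries f (σ + t * I) * (6 / ((σ + t * I) * (σ + t * I + 1) * (σ + t * I + 2) * (σ + t * I + 3))) := by
  set K : ℝ → ℂ := fun t ↦ 6 / (((σ : ℂ) + t * I) * ((σ : ℂ) + t * I + 1) * ((σ : ℂ) + t * I + 2) *
    ((σ : ℂ) + t * I + 3)) with hK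
  set G : ℕ → ℝ → ℂ := fun n t ↦ (x : ℂ) ^ (3 + (σ + t * I)) * LSeries.term f (σ + t * I) n with hG
  set F : ℕ → ℝ → ℂ := fun n t ↦ G n t * K t with hF
  have hnormG : ∀ n t, ‖G n t‖ = x ^ (3 + σ) * ‖LSeries.term f σ n‖ := fun n t ↦
    norm_cpow_mul_term f hx σ t n
  have hcontG : ∀ n, Continuous (G n) := fun n ↦ continuous_cpow_mul_term f hx σ n
  have hintK : Integrable K := integrable_kernel hσ
  have hintF : ∀ n, Integrable (F n) := fun n ↦
    hintK.bdd_mul (hcontG n).aestronglyMeasurable (Eventually.of_forall fun t ↦ (hnormG n t).le)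
  have hsumF : Summable fun n ↦ ∫ t, ‖F n t‖ := by
    have hS : Summable fun n ↦ ‖LSeries.term f σ n‖ := hsum.norm
    have := (hS.mul_left (x ^ (3 + σ))).mul_right (∫ t : ℝ, ‖K t‖)
    refine this.congr fun n ↦ ?_
    rw [← integral_const_mul]
    refine integral_congr_ae (Eventually.of_forall fun t ↦ ?_)
    simp only [hF, norm_mul, hnormG n t]
  set g : ℕ → ℂ := fun n ↦ if n = 0 then 0 else f n * (((max (x - n) 0) ^ 3 : ℝ) : ℂ) with hg
  have hterm : ∀ n : ℕ, g n = (1 / (2 * π) : ℂ) * ∫ t, F n t := by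
    intro n
    rcases eq_or_ne n 0 with rfl | hn
    · simp [hg, hF, hG, LSeries.term_zero]
    · simp only [hg, if_neg hn]
      exact apply_mul_posPart_cube_eq_integral f hx hσ hn
  have hlhs : ∑ n ∈ Finset.Ioc 0 ⌊x⌋₊, f n * ((x : ℂ) - n) ^ 3 = ∑' n : ℕ, g n := by
    rw [tsum_eq_sum (s := Finset.Ioc 0 ⌊x⌋₊)]
    · refine Finset.sum_congr rfl fun n hn ↦ ?_
      rw [Finset.mem_Ioc] at hn
      have hnx : (n : ℝ) ≤ x := (Nat.cast_le.2 hn.2).trans (Nat.floor_le hx.le)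
      simp only [hg, if_neg hn.1.ne', max_eq_left (sub_nonneg.2 hnx)]
      push_cast; ring
    · intro n hn
      rw [Finset.mem_Ioc, not_and_or, not_lt, not_le] at hn
      rcases hn with hn | hn
      · simp [hg, Nat.le_zero.1 hn]
      · have hxn : x < n := by
          have := Nat.lt_of_floor_lt hn
          exact_mod_cast this
        have hn0 : n ≠ 0 := by rintro rfl; simp at hn
        simp only [hg, if_neg hn0, max_eq_right (sub_nonpos.2 hxn.le)]
        simp
  rw [hlhs, tsum_congr hterm, tsum_mul_left, integral_tsum_of_summable_integral_norm hintF hsumF]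
  congr 1
  refine integral_congr_ae (Eventually.of_forall fun t ↦ ?_)
  simp only [hF, hG, hK]
  rw [LSeries, ← tsum_mul_left, ← tsum_mul_right]

/-! ## The value at `0` of the continuation: shifting the line to `Re u = −3/4` -/

/-- `K₁ + |t| ≤ K₁ (1 + |t|)` for `K₁ ≥ 1`. [folklore] -/
theorem add_abs_le_mul {K₁ t : ℝ} (hK₁ : 1 ≤ K₁) : K₁ + |t| ≤ K₁ * (1 + |t|) := by
  nlinarith [abs_nonneg t]

/-- The shifted integrand `F(u) = x^{3+u} Φ(u) · 6/(u(u+1)(u+2)(u+3))` on a line `Re u = σ'` at distance `≥ δ` from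
`{0,−1,−2,−3}` is dominated by `96 x^{3+σ'} A K₁² δ⁻⁴ (1 + t²)⁻¹` when `‖Φ(u)‖ ≤ A (K₁ + |Im u|)²` there. [folklore] -/
theorem norm_integrand_le {Φ : ℂ → ℂ} {x σ' δ A K₁ : ℝ} (hx : 0 < x) (hδ : 0 < δ) (hδ1 : δ ≤ 1)
    (h0 : δ ≤ |σ'|) (h1 : δ ≤ |σ' + 1|) (h2 : δ ≤ |σ' + 2|) (h3 : δ ≤ |σ' + 3|) (hA : 0 ≤ A) (hK₁ : 1 ≤ K₁)
    (t : ℝ) (hΦ : ‖Φ ((σ' : ℂ) + t * I)‖ ≤ A * (K₁ + |t|) ^ 2) :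
    ‖(x : ℂ) ^ (3 + ((σ' : ℂ) + t * I)) * Φ ((σ' : ℂ) + t * I) *
        (6 / ((((σ' : ℂ) + t * I)) * (((σ' : ℂ) + t * I) + 1) * (((σ' : ℂ) + t * I) + 2) *
          (((σ' : ℂ) + t * I) + 3)))‖ ≤
      96 * x ^ (3 + σ') * A * K₁ ^ 2 / δ ^ 4 * (1 + t ^ 2)⁻¹ := by
  have hk := norm_kernel_le (s := (σ' : ℂ) + t * I) hδ hδ1 (by simpa using h0) (by simpa using h1)
    (by simpa using h2) (by simpa using h3)
  simp only [add_im, ofReal_im, mul_im, ofReal_re, I_im, mul_one, I_re, mul_zero, add_zero, zero_add] at hk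
  rw [norm_mul, norm_mul, norm_cpow_eq_rpow_re_of_pos hx]
  simp only [add_re, re_ofNat, ofReal_re, mul_re, I_re, mul_zero, ofReal_im, I_im, mul_one, sub_self,
    add_zero]
  have hKt : (K₁ + |t|) ^ 2 ≤ K₁ ^ 2 * (1 + |t|) ^ 2 := by
    have := add_abs_le_mul (t := t) hK₁
    have h0' : 0 ≤ K₁ + |t| := by positivity
    calc (K₁ + |t|) ^ 2 ≤ (K₁ * (1 + |t|)) ^ 2 := pow_le_pow_left₀ h0' this 2
      _ = K₁ ^ 2 * (1 + |t|) ^ 2 := by ring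
  have h1t : 0 < 1 + |t| := by positivity
  have hsq : 1 + t ^ 2 ≤ (1 + |t|) ^ 2 := by rw [← sq_abs t]; nlinarith [abs_nonneg t]
  have hxp : 0 ≤ x ^ (3 + σ') := Real.rpow_nonneg hx.le _
  have hΦ' : ‖Φ ((σ' : ℂ) + t * I)‖ ≤ A * (K₁ ^ 2 * (1 + |t|) ^ 2) :=
    hΦ.trans (mul_le_mul_of_nonneg_left hKt hA)
  calc x ^ (3 + σ') * ‖Φ ((σ' : ℂ) + t * I)‖ *
        ‖(6 : ℂ) / (((σ' : ℂ) + t * I) * ((σ' : ℂ) + t * I + 1) * ((σ' : ℂ) + t * I + 2) * ((σ' : ℂ) + t * I + 3))‖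
      ≤ x ^ (3 + σ') * (A * (K₁ ^ 2 * (1 + |t|) ^ 2)) * (96 / (δ ^ 4 * (1 + |t|) ^ 4)) :=
        mul_le_mul (mul_le_mul_of_nonneg_left hΦ' hxp) hk (norm_nonneg _) (by positivity)
    _ = 96 * x ^ (3 + σ') * A * K₁ ^ 2 / δ ^ 4 * ((1 + |t|) ^ 2)⁻¹ := by
        field_simp
    _ ≤ 96 * x ^ (3 + σ') * A * K₁ ^ 2 / δ ^ 4 * (1 + t ^ 2)⁻¹ :=
        mul_le_mul_of_nonneg_left (inv_anti₀ (by positivity) hsq) (by positivity)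

/-- Continuity in `t` of the shifted integrand along `Re u = σ'` (`σ' ∉ {0,−1,−2,−3}`), for `Φ` continuous.
[folklore] -/
theorem continuous_integrand {Φ : ℂ → ℂ} (hΦ : Continuous Φ) {x σ' δ : ℝ} (hx : 0 < x) (hδ : 0 < δ)
    (hδ1 : δ ≤ 1) (h0 : δ ≤ |σ'|) (h1 : δ ≤ |σ' + 1|) (h2 : δ ≤ |σ' + 2|) (h3 : δ ≤ |σ' + 3|) :
    Continuous fun t : ℝ ↦ (x : ℂ) ^ (3 + ((σ' : ℂ) + t * I)) * Φ ((σ' : ℂ) + t * I) *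
        (6 / ((((σ' : ℂ) + t * I)) * (((σ' : ℂ) + t * I) + 1) * (((σ' : ℂ) + t * I) + 2) *
          (((σ' : ℂ) + t * I) + 3))) := by
  have hx0 : (x : ℂ) ≠ 0 := ofReal_ne_zero.2 hx.ne'
  have hden : ∀ t : ℝ, ((σ' : ℂ) + t * I) * ((σ' : ℂ) + t * I + 1) * ((σ' : ℂ) + t * I + 2) *
      ((σ' : ℂ) + t * I + 3) ≠ 0 := fun t ↦
    kernelDen_ne_zero (s := (σ' : ℂ) + t * I) hδ hδ1 (by simpa using h0) (by simpa using h1)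
      (by simpa using h2) (by simpa using h3)
  refine (Continuous.mul ?_ (hΦ.comp (by fun_prop))).mul (Continuous.div continuous_const (by fun_prop) hden)
  refine continuous_iff_continuousAt.2 fun t ↦ ?_
  exact (continuousAt_const_cpow hx0).comp (f := fun t : ℝ ↦ 3 + ((σ' : ℂ) + t * I)) (by fun_prop)

/-- Integrability of the shifted integrand along `Re u = σ'`. [folklore] -/
theorem integrable_integrand {Φ : ℂ → ℂ} (hΦc : Continuous Φ) {x σ' δ A K₁ : ℝ} (hx : 0 < x) (hδ : 0 < δ)
    (hδ1 : δ ≤ 1) (h0 : δ ≤ |σ'|) (h1 : δ ≤ |σ' + 1|) (h2 : δ ≤ |σ' + 2|) (h3 : δ ≤ |σ' + 3|) (hA : 0 ≤ A)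
    (hK₁ : 1 ≤ K₁) (hΦ : ∀ t : ℝ, ‖Φ ((σ' : ℂ) + t * I)‖ ≤ A * (K₁ + |t|) ^ 2) :
    Integrable fun t : ℝ ↦ (x : ℂ) ^ (3 + ((σ' : ℂ) + t * I)) * Φ ((σ' : ℂ) + t * I) *
        (6 / ((((σ' : ℂ) + t * I)) * (((σ' : ℂ) + t * I) + 1) * (((σ' : ℂ) + t * I) + 2) *
          (((σ' : ℂ) + t * I) + 3))) := by
  refine ((integrable_inv_one_add_sq.const_mul (96 * x ^ (3 + σ') * A * K₁ ^ 2 / δ ^ 4))).mono'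
    (continuous_integrand hΦc hx hδ hδ1 h0 h1 h2 h3).aestronglyMeasurable (Eventually.of_forall fun t ↦ ?_)
  exact norm_integrand_le hx hδ hδ1 h0 h1 h2 h3 hA hK₁ t (hΦ t)

/-- `∫ (1 + t²)⁻¹ dt = π` packaged as a bound: `∫ C (1+t²)⁻¹ = C π`. [folklore] -/
theorem integral_const_mul_inv_one_add_sq (C : ℝ) : ∫ t : ℝ, C * (1 + t ^ 2)⁻¹ = C * π := by
  rw [integral_const_mul, integral_univ_inv_one_add_sq]

set_option maxHeartbeats 800000 in
/-- **The value at the origin of the continued Dirichlet series.**  Let `c > 0`, `x ≥ 1`, `A ≥ 0`, `K₁ ≥ 1`,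
let `Φ` be entire with `‖Φ(u)‖ ≤ A (K₁ + |Im u|)²` for `−3/4 ≤ Re u ≤ c`, and let `∑ f(n) n^{-c}` converge absolutely
with `L(f, c + it) = Φ(c + it)` for all real `t`.  Then
`‖Φ(0)‖ ≤ x⁻³ ‖∑_{n ≤ x} f(n)(x − n)³‖ + 12288 · A · K₁² · x^{−3/4}`.
Proof: Perron's formula of order three on `Re u = c`; the residue theorem for the strip `−3/4 ≤ Re u ≤ c`
(`Literature.Analysis.Complex.integral_vertical_sub_eq_sum_of_simplePoles`) with the single simple pole `u = 0`
of `x^{3+u}Φ(u)·6/(u(u+1)(u+2)(u+3))`, residue `x³Φ(0)`; on `Re u = −3/4` the integrand is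
`≤ 96·4⁴ x^{9/4} A K₁² (1+t²)⁻¹`, on the horizontal segments it is `≤ 24 x^{3+c} A K₁² T⁻² → 0`.
[cite: Titchmarsh1986, §5.3] [cite: MontgomeryVaughan2007, §5.1 (5.19)] -/
theorem norm_apply_zero_le (f : ℕ → ℂ) {Φ : ℂ → ℂ} (hΦd : Differentiable ℂ Φ) {c : ℝ} (hc : 0 < c)
    {x : ℝ} (hx : 1 ≤ x) {A K₁ : ℝ} (hA : 0 ≤ A) (hK₁ : 1 ≤ K₁)
    (hbound : ∀ u : ℂ, -3 / 4 ≤ u.re → u.re ≤ c → ‖Φ u‖ ≤ A * (K₁ + |u.im|) ^ 2)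
    (hsum : LSeriesSummable f c) (hL : ∀ t : ℝ, LSeries f (c + t * I) = Φ (c + t * I)) :
    ‖Φ 0‖ ≤ x ^ (-(3 : ℝ)) * ‖∑ n ∈ Finset.Ioc 0 ⌊x⌋₊, f n * ((x : ℂ) - n) ^ 3‖ +
      12288 * A * K₁ ^ 2 * x ^ (-(3 / 4 : ℝ)) := by
  have hx0 : 0 < x := by linarith
  have hxC : (x : ℂ) ≠ 0 := ofReal_ne_zero.2 hx0.ne'
  have hΦc : Continuous Φ := hΦd.continuous
  -- the integrand
  set F : ℂ → ℂ := fun u ↦ (x : ℂ) ^ (3 + u) * Φ u * (6 / (u * (u + 1) * (u + 2) * (u + 3))) with hFdef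
  have hFline : ∀ σ' t : ℝ, F ((σ' : ℂ) + t * I) = (x : ℂ) ^ (3 + ((σ' : ℂ) + t * I)) * Φ ((σ' : ℂ) + t * I) *
      (6 / ((((σ' : ℂ) + t * I)) * (((σ' : ℂ) + t * I) + 1) * (((σ' : ℂ) + t * I) + 2) *
        (((σ' : ℂ) + t * I) + 3))) := fun σ' t ↦ rfl
  -- distances to the poles on the two lines
  set δ : ℝ := min c 1 / 4 with hδdef
  have hδ0 : 0 < δ := by rw [hδdef]; have := lt_min hc one_pos; positivity
  have hδ1 : δ ≤ 1 := by rw [hδdef]; have := min_le_right c 1; linarith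
  have hδc : δ ≤ c := by rw [hδdef]; have := min_le_left c 1; have := lt_min hc one_pos; linarith
  have hδq : δ ≤ 1 / 4 := by rw [hδdef]; have := min_le_right c 1; linarith
  -- right line `Re u = c`
  have hr0 : δ ≤ |c| := by rw [abs_of_pos hc]; exact hδc
  have hr1 : δ ≤ |c + 1| := by rw [abs_of_pos (by linarith)]; linarith
  have hr2 : δ ≤ |c + 2| := by rw [abs_of_pos (by linarith)]; linarith
  have hr3 : δ ≤ |c + 3| := by rw [abs_of_pos (by linarith)]; linarith
  -- left line `Re u = -3/4`
  have hl0 : δ ≤ |(-3 / 4 : ℝ)| := by rw [abs_of_neg (by norm_num)]; linarith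
  have hl1 : δ ≤ |(-3 / 4 : ℝ) + 1| := by rw [abs_of_pos (by norm_num)]; linarith
  have hl2 : δ ≤ |(-3 / 4 : ℝ) + 2| := by rw [abs_of_pos (by norm_num)]; linarith
  have hl3 : δ ≤ |(-3 / 4 : ℝ) + 3| := by rw [abs_of_pos (by norm_num)]; linarith
  have hΦr : ∀ t : ℝ, ‖Φ ((c : ℂ) + t * I)‖ ≤ A * (K₁ + |t|) ^ 2 := fun t ↦ by
    have := hbound ((c : ℂ) + t * I) (by simp; linarith) (by simp)
    simpa using this
  have hΦl : ∀ t : ℝ, ‖Φ (((-3 / 4 : ℝ) : ℂ) + t * I)‖ ≤ A * (K₁ + |t|) ^ 2 := fun t ↦ by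
    have := hbound (((-3 / 4 : ℝ) : ℂ) + t * I) (by simp) (by simp; linarith)
    simpa using this
  have hint_r : Integrable fun t : ℝ ↦ F ((c : ℂ) + t * I) :=
    integrable_integrand hΦc hx0 hδ0 hδ1 hr0 hr1 hr2 hr3 hA hK₁ hΦr
  have hint_l : Integrable fun t : ℝ ↦ F (((-3 / 4 : ℝ) : ℂ) + t * I) :=
    integrable_integrand hΦc hx0 hδ0 hδ1 hl0 hl1 hl2 hl3 hA hK₁ hΦl
  -- ### the residue theorem on the strip `-3/4 ≤ Re u ≤ c`
  set U : Set ℂ := {u : ℂ | -7 / 8 < u.re} with hUdef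
  have hU : IsOpen U := isOpen_lt continuous_const Complex.continuous_re
  have hKU : re ⁻¹' Icc (-3 / 4 : ℝ) c ⊆ U := fun u hu ↦ by
    simp only [hUdef, Set.mem_setOf_eq]
    exact lt_of_lt_of_le (by norm_num) hu.1
  have hS : ∀ p ∈ ({0} : Finset ℂ), p.re ∈ Ioo (-3 / 4 : ℝ) c := by
    intro p hp
    rw [Finset.mem_singleton] at hp
    rw [hp, Complex.zero_re, Set.mem_Ioo]
    constructor <;> linarith
  have hden_ne : ∀ u ∈ U, u ≠ 0 → u * (u + 1) * (u + 2) * (u + 3) ≠ 0 := by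
    intro u hu hu0
    simp only [hUdef, Set.mem_setOf_eq] at hu
    have n1 : u + 1 ≠ 0 := fun h ↦ by have := congrArg Complex.re h; simp at this; linarith
    have n2 : u + 2 ≠ 0 := fun h ↦ by have := congrArg Complex.re h; simp at this; linarith
    have n3 : u + 3 ≠ 0 := fun h ↦ by have := congrArg Complex.re h; simp at this; linarith
    exact mul_ne_zero (mul_ne_zero (mul_ne_zero hu0 n1) n2) n3
  have hFdiff : DifferentiableOn ℂ F (U \ ↑({0} : Finset ℂ)) := by
    intro u hu
    obtain ⟨hu1, hu2⟩ := hu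
    have hu0 : u ≠ 0 := by simpa using hu2
    have hd := hden_ne u hu1 hu0
    refine DifferentiableAt.differentiableWithinAt ?_
    refine ((DifferentiableAt.const_cpow (by fun_prop) (Or.inl hxC)).mul (hΦd u)).mul ?_
    exact (differentiableAt_const _).div (by fun_prop) hd
  -- the pole at `0`
  set φ : ℂ → ℂ := fun u ↦ (x : ℂ) ^ (3 + u) * Φ u * (6 / ((u + 1) * (u + 2) * (u + 3))) with hφdef
  have hpole : ∀ p ∈ ({0} : Finset ℂ), ∃ φ' : ℂ → ℂ, ∃ V ∈ 𝓝 p, DifferentiableOn ℂ φ' V ∧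
      φ' p = (fun _ : ℂ ↦ (x : ℂ) ^ (3 : ℂ) * Φ 0) p ∧ ∀ z ∈ V, z ≠ p → F z = φ' z / (z - p) := by
    intro p hp
    rw [Finset.mem_singleton] at hp
    subst hp
    refine ⟨φ, Metric.ball 0 (1 / 2), Metric.ball_mem_nhds _ (by norm_num), ?_, ?_, ?_⟩
    · intro u hu
      have hu' : ‖u‖ < 1 / 2 := by simpa using hu
      have hre : |u.re| < 1 / 2 := lt_of_le_of_lt (Complex.abs_re_le_norm u) hu'
      rw [abs_lt] at hre
      have n1 : u + 1 ≠ 0 := fun h ↦ by have := congrArg Complex.re h; simp at this; linarith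
      have n2 : u + 2 ≠ 0 := fun h ↦ by have := congrArg Complex.re h; simp at this; linarith
      have n3 : u + 3 ≠ 0 := fun h ↦ by have := congrArg Complex.re h; simp at this; linarith
      refine DifferentiableAt.differentiableWithinAt ?_
      refine ((DifferentiableAt.const_cpow (by fun_prop) (Or.inl hxC)).mul (hΦd u)).mul ?_
      exact (differentiableAt_const _).div (by fun_prop) (mul_ne_zero (mul_ne_zero n1 n2) n3)
    · simp only [hφdef, add_zero, zero_add]
      norm_num
    · intro z hz hz0
      rw [sub_zero]
      have hz' : ‖z‖ < 1 / 2 := by simpa using hz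
      have hre : |z.re| < 1 / 2 := lt_of_le_of_lt (Complex.abs_re_le_norm z) hz'
      rw [abs_lt] at hre
      have n1 : z + 1 ≠ 0 := fun h ↦ by have := congrArg Complex.re h; simp at this; linarith
      have n2 : z + 2 ≠ 0 := fun h ↦ by have := congrArg Complex.re h; simp at this; linarith
      have n3 : z + 3 ≠ 0 := fun h ↦ by have := congrArg Complex.re h; simp at this; linarith
      simp only [hFdef, hφdef]
      field_simp
  -- decay on horizontal segments
  have hdecay : ∀ ε : ℝ, 0 < ε → ∃ T₀ : ℝ, ∀ T : ℝ, T₀ ≤ |T| → ∀ y ∈ Icc (-3 / 4 : ℝ) c,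
      ‖F (y + T * I)‖ ≤ ε := by
    intro ε hε
    set B : ℝ := 24 * x ^ (3 + c) * A * K₁ ^ 2 with hBdef
    have hB0 : 0 ≤ B := by rw [hBdef]; have := Real.rpow_nonneg hx0.le (3 + c); positivity
    refine ⟨max 1 (Real.sqrt (B / ε) + 1), fun T hT y hy ↦ ?_⟩
    have hT1 : 1 ≤ |T| := le_trans (le_max_left _ _) hT
    have hTs : Real.sqrt (B / ε) < |T| := lt_of_lt_of_le (by linarith [le_max_right 1 (Real.sqrt (B / ε) + 1)]) hT
    have hT0 : 0 < |T| := by linarith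
    obtain ⟨hy1, hy2⟩ := hy
    -- kernel bound `6/T⁴`
    set u : ℂ := (y : ℂ) + T * I with hudef
    have him : u.im = T := by simp [hudef]
    have hfac : ∀ j : ℝ, |T| ≤ ‖u + j‖ := fun j ↦ by
      have := Complex.abs_im_le_norm (u + j); simpa [hudef] using this
    have hk : ‖(6 : ℂ) / (u * (u + 1) * (u + 2) * (u + 3))‖ ≤ 6 / |T| ^ 4 := by
      have g0 := hfac 0; have g1 := hfac 1; have g2 := hfac 2; have g3 := hfac 3
      simp only [ofReal_zero, add_zero] at g0
      simp only [ofReal_one] at g1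
      rw [show ((2 : ℝ) : ℂ) = 2 by norm_num] at g2
      rw [show ((3 : ℝ) : ℂ) = 3 by norm_num] at g3
      have hprod : |T| ^ 4 ≤ ‖u * (u + 1) * (u + 2) * (u + 3)‖ := by
        rw [norm_mul, norm_mul, norm_mul]
        calc |T| ^ 4 = |T| * |T| * |T| * |T| := by ring
          _ ≤ ‖u‖ * ‖u + 1‖ * ‖u + 2‖ * ‖u + 3‖ := by
              apply mul_le_mul (mul_le_mul (mul_le_mul g0 g1 hT0.le (norm_nonneg _)) g2 hT0.le (by positivity))
                g3 hT0.le (by positivity)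
      have hpos : 0 < ‖u * (u + 1) * (u + 2) * (u + 3)‖ := lt_of_lt_of_le (by positivity) hprod
      rw [norm_div, show ‖(6 : ℂ)‖ = 6 by simp, div_le_div_iff₀ hpos (by positivity)]
      nlinarith
    have hxu : ‖(x : ℂ) ^ (3 + u)‖ ≤ x ^ (3 + c) := by
      rw [norm_cpow_eq_rpow_re_of_pos hx0]
      refine Real.rpow_le_rpow_of_exponent_le hx ?_
      simp [hudef]; exact hy2
    have hΦu : ‖Φ u‖ ≤ A * (K₁ ^ 2 * (4 * |T| ^ 2)) := by
      have h1 := hbound u (by simp [hudef]; exact hy1) (by simp [hudef]; exact hy2)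
      rw [him] at h1
      refine h1.trans (mul_le_mul_of_nonneg_left ?_ hA)
      have h2 := add_abs_le_mul (t := T) hK₁
      calc (K₁ + |T|) ^ 2 ≤ (K₁ * (1 + |T|)) ^ 2 := pow_le_pow_left₀ (by positivity) h2 2
        _ = K₁ ^ 2 * (1 + |T|) ^ 2 := by ring
        _ ≤ K₁ ^ 2 * (4 * |T| ^ 2) := by
            refine mul_le_mul_of_nonneg_left ?_ (by positivity)
            nlinarith
    calc ‖F u‖ = ‖(x : ℂ) ^ (3 + u)‖ * ‖Φ u‖ * ‖(6 : ℂ) / (u * (u + 1) * (u + 2) * (u + 3))‖ := by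
          rw [hFdef]; simp only [norm_mul]
      _ ≤ x ^ (3 + c) * (A * (K₁ ^ 2 * (4 * |T| ^ 2))) * (6 / |T| ^ 4) := by
          gcongr
      _ = B / |T| ^ 2 := by
          rw [hBdef]; field_simp; ring
      _ ≤ ε := by
          rw [div_le_iff₀ (by positivity)]
          have hsq : B / ε < |T| ^ 2 := by
            have h1 : Real.sqrt (B / ε) ^ 2 = B / ε := Real.sq_sqrt (by positivity)
            have h2 : Real.sqrt (B / ε) ^ 2 < |T| ^ 2 := by
              exact pow_lt_pow_left₀ hTs (Real.sqrt_nonneg _) two_ne_zero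
            linarith
          rw [div_lt_iff₀ hε] at hsq
          linarith
  have hres := Literature.Analysis.Complex.integral_vertical_sub_eq_sum_of_simplePoles (F := F)
    (a := -3 / 4) (b := c) (by linarith) ({0} : Finset ℂ) (fun _ : ℂ ↦ (x : ℂ) ^ (3 : ℂ) * Φ 0) U hU hKU hS
    hFdiff hpole hint_l hint_r hdecay
  rw [Finset.sum_singleton] at hres
  -- ### Perron on the right line
  have hperron := sum_mul_sub_cube_eq_integral_LSeries f hx0 hc hsum
  have hright : ∫ t : ℝ, F ((c : ℂ) + t * I) = ∫ t : ℝ, (x : ℂ) ^ (3 + (c + t * I)) *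
      LSeries f (c + t * I) * (6 / ((c + t * I) * (c + t * I + 1) * (c + t * I + 2) * (c + t * I + 3))) := by
    refine integral_congr_ae (Eventually.of_forall fun t ↦ ?_)
    simp only [hFdef, hL t]
  -- `x³ Φ(0) = (1/2π)(∫_right − ∫_left)`
  have hkey : (x : ℂ) ^ (3 : ℂ) * Φ 0 =
      (1 / (2 * π) : ℂ) * (∫ t : ℝ, F ((c : ℂ) + t * I)) - (1 / (2 * π) : ℂ) * ∫ t : ℝ, F (((-3 / 4 : ℝ) : ℂ) + t * I) := by
    have hπ : (2 * π : ℂ) ≠ 0 := by exact_mod_cast (by positivity : (2 * Real.pi) ≠ 0)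
    rw [← mul_sub, hres, ← mul_assoc, one_div_mul_cancel hπ, one_mul]
  rw [hright, ← hperron] at hkey
  -- ### the bound on the left line
  have hleft : ‖∫ t : ℝ, F (((-3 / 4 : ℝ) : ℂ) + t * I)‖ ≤ 96 * x ^ (3 + (-3 / 4 : ℝ)) * A * K₁ ^ 2 / δ ^ 4 * π := by
    calc ‖∫ t : ℝ, F (((-3 / 4 : ℝ) : ℂ) + t * I)‖ ≤ ∫ t : ℝ, ‖F (((-3 / 4 : ℝ) : ℂ) + t * I)‖ :=
          norm_integral_le_integral_norm _
      _ ≤ ∫ t : ℝ, 96 * x ^ (3 + (-3 / 4 : ℝ)) * A * K₁ ^ 2 / δ ^ 4 * (1 + t ^ 2)⁻¹ := by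
          refine integral_mono hint_l.norm (integrable_inv_one_add_sq.const_mul _) fun t ↦ ?_
          exact norm_integrand_le hx0 hδ0 hδ1 hl0 hl1 hl2 hl3 hA hK₁ t (hΦl t)
      _ = 96 * x ^ (3 + (-3 / 4 : ℝ)) * A * K₁ ^ 2 / δ ^ 4 * π := integral_const_mul_inv_one_add_sq _
  -- `δ ≥ ?`: we only know `δ ≤ 1/4`; use instead the explicit left-line distance `1/4`
  -- (redo the left bound with `δ' = 1/4`, which is legitimate on the left line)
  have hleft' : ‖∫ t : ℝ, F (((-3 / 4 : ℝ) : ℂ) + t * I)‖ ≤ 96 * x ^ (3 + (-3 / 4 : ℝ)) * A * K₁ ^ 2 / (1 / 4 : ℝ) ^ 4 * π := by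
    have hq0 : (0 : ℝ) < 1 / 4 := by norm_num
    have hq1 : (1 / 4 : ℝ) ≤ 1 := by norm_num
    have k0 : (1 / 4 : ℝ) ≤ |(-3 / 4 : ℝ)| := by rw [abs_of_neg (by norm_num)]; norm_num
    have k1 : (1 / 4 : ℝ) ≤ |(-3 / 4 : ℝ) + 1| := by rw [abs_of_pos (by norm_num)]; norm_num
    have k2 : (1 / 4 : ℝ) ≤ |(-3 / 4 : ℝ) + 2| := by rw [abs_of_pos (by norm_num)]; norm_num
    have k3 : (1 / 4 : ℝ) ≤ |(-3 / 4 : ℝ) + 3| := by rw [abs_of_pos (by norm_num)]; norm_num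
    calc ‖∫ t : ℝ, F (((-3 / 4 : ℝ) : ℂ) + t * I)‖ ≤ ∫ t : ℝ, ‖F (((-3 / 4 : ℝ) : ℂ) + t * I)‖ :=
          norm_integral_le_integral_norm _
      _ ≤ ∫ t : ℝ, 96 * x ^ (3 + (-3 / 4 : ℝ)) * A * K₁ ^ 2 / (1 / 4 : ℝ) ^ 4 * (1 + t ^ 2)⁻¹ := by
          refine integral_mono hint_l.norm (integrable_inv_one_add_sq.const_mul _) fun t ↦ ?_
          exact norm_integrand_le hx0 hq0 hq1 k0 k1 k2 k3 hA hK₁ t (hΦl t)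
      _ = 96 * x ^ (3 + (-3 / 4 : ℝ)) * A * K₁ ^ 2 / (1 / 4 : ℝ) ^ 4 * π := integral_const_mul_inv_one_add_sq _
  -- ### conclusion
  have hx3 : ‖(x : ℂ) ^ (3 : ℂ)‖ = x ^ (3 : ℝ) := by
    rw [show (3 : ℂ) = ((3 : ℝ) : ℂ) by norm_num, norm_cpow_eq_rpow_re_of_pos hx0, ofReal_re]
  have hx3pos : 0 < x ^ (3 : ℝ) := Real.rpow_pos_of_pos hx0 _
  have hπnorm : ‖(1 / (2 * π) : ℂ)‖ = 1 / (2 * π) := by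
    rw [show (1 / (2 * π) : ℂ) = ((1 / (2 * π) : ℝ) : ℂ) by push_cast; ring, Complex.norm_real,
      Real.norm_of_nonneg (by positivity)]
  have hmain : x ^ (3 : ℝ) * ‖Φ 0‖ ≤ ‖∑ n ∈ Finset.Ioc 0 ⌊x⌋₊, f n * ((x : ℂ) - n) ^ 3‖ +
      1 / (2 * π) * (96 * x ^ (3 + (-3 / 4 : ℝ)) * A * K₁ ^ 2 / (1 / 4 : ℝ) ^ 4 * π) := by
    calc x ^ (3 : ℝ) * ‖Φ 0‖ = ‖(x : ℂ) ^ (3 : ℂ) * Φ 0‖ := by rw [norm_mul, hx3]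
      _ = ‖∑ n ∈ Finset.Ioc 0 ⌊x⌋₊, f n * ((x : ℂ) - n) ^ 3 -
            (1 / (2 * π) : ℂ) * ∫ t : ℝ, F (((-3 / 4 : ℝ) : ℂ) + t * I)‖ := by rw [hkey]
      _ ≤ ‖∑ n ∈ Finset.Ioc 0 ⌊x⌋₊, f n * ((x : ℂ) - n) ^ 3‖ +
            ‖(1 / (2 * π) : ℂ) * ∫ t : ℝ, F (((-3 / 4 : ℝ) : ℂ) + t * I)‖ := norm_sub_le _ _
      _ ≤ _ := by
          rw [norm_mul, hπnorm]
          gcongr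
  -- divide by `x³`
  have e1 : x ^ (-(3 : ℝ)) * (x ^ (3 : ℝ) * ‖Φ 0‖) = ‖Φ 0‖ := by
    rw [← mul_assoc, ← Real.rpow_add hx0]; norm_num
  have e2 : x ^ (-(3 : ℝ)) * (1 / (2 * π) * (96 * x ^ (3 + (-3 / 4 : ℝ)) * A * K₁ ^ 2 / (1 / 4 : ℝ) ^ 4 * π)) =
      12288 * A * K₁ ^ 2 * x ^ (-(3 / 4 : ℝ)) := by
    have hxe : x ^ (-(3 : ℝ)) * x ^ (3 + (-3 / 4 : ℝ)) = x ^ (-(3 / 4 : ℝ)) := by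
      rw [← Real.rpow_add hx0]; norm_num
    have hπ0 : (π : ℝ) ≠ 0 := Real.pi_pos.ne'
    calc x ^ (-(3 : ℝ)) * (1 / (2 * π) * (96 * x ^ (3 + (-3 / 4 : ℝ)) * A * K₁ ^ 2 / (1 / 4 : ℝ) ^ 4 * π))
        = (x ^ (-(3 : ℝ)) * x ^ (3 + (-3 / 4 : ℝ))) * A * K₁ ^ 2 * (96 / (1 / 4 : ℝ) ^ 4 / 2) * (π / π) := by ring
      _ = 12288 * A * K₁ ^ 2 * x ^ (-(3 / 4 : ℝ)) := by rw [hxe, div_self hπ0]; norm_num; ring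
  have hxm0 : 0 < x ^ (-(3 : ℝ)) := Real.rpow_pos_of_pos hx0 _
  have := mul_le_mul_of_nonneg_left hmain hxm0.le
  rw [e1, mul_add, e2] at this
  exact this

end RieszPerron3

end Literature.NumberTheory.LFunctions
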